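import Summits.BirchSwinnertonDyer.BirchSwinnertonDyer.Theorems.ErratumRoadFiveAuxPrimeFrobeniusWitness
import Literature.NumberTheory.GaloisRepresentations.NormalSubgroupsGL2
import Literature.NumberTheory.EllipticCurves.SerreOpenImageDeterminantProofs
import HarnessLib

/-!
# Kummer descent for the aux-norm line: from `K(ζ_{p^E}, E[p])` down to `K(ζ_{p^E})` and to `K`

Helper file for crux `stmt-BirchSwinnertonDyer-19715`, line `aux_norm_receptacle`, stub S3♭
`stub_auxiliaryPrimeSupply` — step (F3b-2) of F1–F4 (seat bsd-line-er5-p1-w2 g5). Theorems only;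
nothing here closes 19715.  Everything is phrased inside `Γ_ℚ` acting on `ℚ̄`, with
`H = res Γ_K ≤ Γ_ℚ` (index `2`), `ζ` a primitive `p^E`-th root of unity (`E ≥ 1`), and an element
`y ∈ ℚ̄` whose `p`-th power `x` is fixed by `H` (`x ∈ K`).

* `pow_mem_of_perfect_commutator` — abstract group theory: if `R : Γ → G` is onto, `D = [G,G]` is
  perfect with `a^m ∈ D` for all `a`, every commutator of `Γ` lies in `H₀ ≤ Γ`, and `S ≤ H₀`
  contains `H₀ ∩ ker R` and all commutators of elements of `H₀`, then `g^m ∈ S` for `g ∈ H₀`.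
* `commutator_top_eq_det_ker`, `pow_sub_one_mem_commutator` — in `GL₂(𝔽_p)`, `p ≥ 5`:
  `[GL₂, GL₂] = SL₂ = ker det` is perfect (Mathlib `Matrix.SL2.commutator_eq_top`) and contains
  every `(p-1)`-th power.
* **`smul_eq_of_fixed_by_ker_galoisRep`** (SL₂ descent) — if `y` is fixed by
  `H ∩ Stab ζ ∩ ker ρ̄_{E,p}` (`ρ̄_{E,p}` onto, `p ≥ 5`) then `y` is fixed by `H ∩ Stab ζ`:
  `g ↦ g y / y` is a character of `H ∩ Stab ζ` into `μ_p`, trivial on `ker ρ̄`, and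
  `ρ̄(H ∩ Stab ζ) ⊇ [Aut E[p], Aut E[p]] ≅ SL₂(𝔽_p)` is perfect of index `p - 1`.
* **`exists_fixed_root_of_fixed_by_stabilizer`** (cyclic descent) — if `y` is fixed by
  `H ∩ Stab ζ` then some `y₀` with `y₀^p = y^p` is fixed by all of `H`: with `ω_g = g y / y` and
  `c ∈ H` moving `ζ_p = ζ^{p^{E-1}}` (it exists: `ζ_p ∉ K` as `p - 1 > 2`), the commutator trick
  `g c ≡ c g` on `K(ζ)` gives `ω_g^{χ(c)-1} = ω_c^{χ(g)-1}`, so `ω_g = θ^{χ(g)-1} = gθ/θ` for a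
  suitable `θ ∈ μ_p` (`H¹(Gal(K(ζ)/K), μ_p) = 0`), and `y₀ = y/θ`.
* `exists_eq_embedding_of_forall_smul` — the fixed field of `H` on `ℚ̄` is `e(K)` for the
  embedding `e` of `exists_mem_range_absGaloisRestrict_iff` (infinite Galois correspondence).

References: B. H. Gross, LMS LNS 153 (1991), §9 [GrossLMS1991]; J.-P. Serre, Invent. Math. 15
(1972), §2 [Serre1972]; Allen et al., Ann. of Math. 197 (2023), §7.1 (SL₂ perfect)
[AllenCalegariCaraianiGeeEtAl2023].
-/

noncomputable section

set_option linter.dupNamespace false -- `Summit.BirchSwinnertonDyer.BirchSwinnertonDyer` (summit = problem), tree-wide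

open scoped Classical NumberField MatrixGroups
open WeierstrassCurve NumberField Field Matrix
open Literature.NumberTheory.GaloisRepresentations Literature.NumberTheory.EllipticCurves

namespace Summit.BirchSwinnertonDyer.BirchSwinnertonDyer.Theorems.AuxPrimeSupply

/-! ### Abstract group theory -/

/-- **Powers into a subgroup seen through a perfect commutator subgroup.** Let `R : Γ →* G` be
onto, `D = [G, G]` perfect with `a^m ∈ D` for every `a ∈ G`; let `S ≤ H₀ ≤ Γ` with every
commutator of `Γ` in `H₀`, `H₀ ∩ ker R ⊆ S`, and every commutator of two elements of `H₀` in `S`.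
Then `g^m ∈ S` for every `g ∈ H₀`. (`R(H₀) ⊇ D`, hence `R(S) ⊇ [D, D] = D ∋ R(g)^m`.) [folklore] -/
theorem pow_mem_of_perfect_commutator {Γ G : Type*} [Group Γ] [Group G] (R : Γ →* G)
    (hR : Function.Surjective R) (hperf : ⁅(⁅(⊤ : Subgroup G), (⊤ : Subgroup G)⁆), (⁅(⊤ : Subgroup G), (⊤ : Subgroup G)⁆)⁆ =
      ⁅(⊤ : Subgroup G), (⊤ : Subgroup G)⁆)
    {m : ℕ} (hm : ∀ a : G, a ^ m ∈ ⁅(⊤ : Subgroup G), (⊤ : Subgroup G)⁆) {H₀ S : Subgroup Γ} (hSH : S ≤ H₀)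
    (hcomm : ∀ x y : Γ, x * y * x⁻¹ * y⁻¹ ∈ H₀) (hker : ∀ g ∈ H₀, R g = 1 → g ∈ S)
    (hScomm : ∀ g ∈ H₀, ∀ g' ∈ H₀, g * g' * g⁻¹ * g'⁻¹ ∈ S) {g : Γ} (hg : g ∈ H₀) :
    g ^ m ∈ S := by
  set D : Subgroup G := ⁅(⊤ : Subgroup G), (⊤ : Subgroup G)⁆ with hD
  -- `D ≤ R(H₀)`
  have hDH : D ≤ H₀.map R := by
    rw [hD, Subgroup.commutator_def, Subgroup.closure_le]
    rintro _ ⟨a, -, b, -, rfl⟩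
    obtain ⟨x, rfl⟩ := hR a
    obtain ⟨y, rfl⟩ := hR b
    refine ⟨x * y * x⁻¹ * y⁻¹, hcomm x y, ?_⟩
    rw [commutatorElement_def, map_mul, map_mul, map_mul, map_inv, map_inv]
  -- `D = [D, D] ≤ R(S)`
  have hDS : D ≤ S.map R := by
    rw [← hperf, Subgroup.commutator_def, Subgroup.closure_le]
    rintro _ ⟨d, hd, d', hd', rfl⟩
    obtain ⟨g₁, hg₁, rfl⟩ := hDH hd
    obtain ⟨g₂, hg₂, rfl⟩ := hDH hd'
    refine ⟨g₁ * g₂ * g₁⁻¹ * g₂⁻¹, hScomm g₁ hg₁ g₂ hg₂, ?_⟩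
    rw [commutatorElement_def, map_mul, map_mul, map_mul, map_inv, map_inv]
  -- `R (g^m) ∈ D ≤ R(S)`
  obtain ⟨s, hs, hRs⟩ := hDS (by rw [hD] at hm ⊢; exact (map_pow R g m) ▸ hm (R g) :
    R (g ^ m) ∈ D)
  have hmem : g ^ m * s⁻¹ ∈ S := hker _ (H₀.mul_mem (H₀.pow_mem hg m) (H₀.inv_mem (hSH hs)))
    (by rw [map_mul, map_inv, ← hRs, mul_inv_cancel])
  have : g ^ m = g ^ m * s⁻¹ * s := by rw [inv_mul_cancel_right]
  rw [this]
  exact S.mul_mem hmem hs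

/-! ### `GL₂(𝔽_p)`: the commutator subgroup is `SL₂ = ker det`, perfect, of exponent dividing `p-1` index -/

/-- In `GL₂(𝔽_p)`, `p ≥ 5`: `[GL₂, GL₂] = ker det` (`= SL₂`, which is perfect by Mathlib's
`Matrix.SL2.commutator_eq_top` with `a = 2`). [cite: AllenCalegariCaraianiGeeEtAl2023, §7.1 (proof of Lemma 7.1.6 (2): SL₂(𝔽_l) is perfect)] -/
theorem commutator_top_eq_det_ker {p : ℕ} [Fact p.Prime] (hp5 : 5 ≤ p) :
    ⁅(⊤ : Subgroup (GL (Fin 2) (ZMod p))), (⊤ : Subgroup (GL (Fin 2) (ZMod p)))⁆ =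
      (GeneralLinearGroup.det : GL (Fin 2) (ZMod p) →* (ZMod p)ˣ).ker := by
  obtain ⟨h2, h3⟩ := BinaryQuartic.two_three_ne_zero_zmod hp5
  have hsq : (2 : ZMod p) ^ 2 ≠ 1 := by
    intro h
    apply h3
    linear_combination h
  have hSL : ⁅(SpecialLinearGroup.toGL : SL(2, ZMod p) →* GL (Fin 2) (ZMod p)).range,
      (SpecialLinearGroup.toGL : SL(2, ZMod p) →* GL (Fin 2) (ZMod p)).range⁆ =
      (SpecialLinearGroup.toGL : SL(2, ZMod p) →* GL (Fin 2) (ZMod p)).range := by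
    rw [MonoidHom.range_eq_map, ← Subgroup.map_commutator, ← commutator_def,
      SL2.commutator_eq_top h2 hsq]
  apply le_antisymm
  · rw [← commutator_def]
    exact Abelianization.commutator_subset_ker _
  · rw [← toGL_range_eq_det_ker, ← hSL]
    exact Subgroup.commutator_mono le_top le_top

/-- `[GL₂(𝔽_p), GL₂(𝔽_p)]` is perfect for `p ≥ 5`. [cite: AllenCalegariCaraianiGeeEtAl2023, §7.1 (SL₂(𝔽_l) perfect, l > 3)] -/
theorem commutator_commutator_top_eq {p : ℕ} [Fact p.Prime] (hp5 : 5 ≤ p) :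
    ⁅(⁅(⊤ : Subgroup (GL (Fin 2) (ZMod p))), (⊤ : Subgroup (GL (Fin 2) (ZMod p)))⁆),
      (⁅(⊤ : Subgroup (GL (Fin 2) (ZMod p))), (⊤ : Subgroup (GL (Fin 2) (ZMod p)))⁆)⁆ =
      ⁅(⊤ : Subgroup (GL (Fin 2) (ZMod p))), (⊤ : Subgroup (GL (Fin 2) (ZMod p)))⁆ := by
  obtain ⟨h2, h3⟩ := BinaryQuartic.two_three_ne_zero_zmod hp5
  have hsq : (2 : ZMod p) ^ 2 ≠ 1 := by
    intro h
    apply h3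
    linear_combination h
  rw [commutator_top_eq_det_ker hp5, ← toGL_range_eq_det_ker, MonoidHom.range_eq_map,
    ← Subgroup.map_commutator, ← commutator_def, SL2.commutator_eq_top h2 hsq]

/-- Every `(p-1)`-th power in `GL₂(𝔽_p)` lies in `[GL₂, GL₂] = ker det` (`det^{p-1} = 1`). [folklore] -/
theorem pow_sub_one_mem_commutator {p : ℕ} [Fact p.Prime] (hp5 : 5 ≤ p)
    (a : GL (Fin 2) (ZMod p)) :
    a ^ (p - 1) ∈ ⁅(⊤ : Subgroup (GL (Fin 2) (ZMod p))), (⊤ : Subgroup (GL (Fin 2) (ZMod p)))⁆ := by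
  rw [commutator_top_eq_det_ker hp5, MonoidHom.mem_ker, map_pow]
  exact ZMod.units_pow_card_sub_one_eq_one p _

/-! ### The SL₂ descent -/

/-- **SL₂ descent.** `W/ℚ` with `ρ̄_{E,p}` onto, `p ≥ 5`, `K` quadratic, `ζ` a primitive `p^E`-th
root of unity (`E ≥ 1`), `H = res Γ_K`.  If `y ∈ ℚ̄` has `y^p = x` with `x` fixed by `H`, and `y`
is fixed by every `g ∈ H` fixing `ζ` and acting trivially on `E[p]`, then `y` is fixed by every
`g ∈ H` fixing `ζ`.  (The character `g ↦ gy/y` of `H ∩ Stab ζ` into `μ_p` dies on `ker ρ̄`, hence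
factors through `ρ̄(H ∩ Stab ζ) ⊇ [Aut E[p], Aut E[p]] ≅ SL₂(𝔽_p)`, perfect and containing all
`(p-1)`-th powers; so it is killed by `p - 1` and by `p`.) [cite: AllenCalegariCaraianiGeeEtAl2023, §7.1 (proof of Lemma 7.1.6 (2))] -/
theorem smul_eq_of_fixed_by_ker_galoisRep (W : WeierstrassCurve ℚ) [W.IsElliptic] {K : Type}
    [Field K] [NumberField K] (hK2 : Module.finrank ℚ K = 2) {p : ℕ} [Fact p.Prime] (hp5 : 5 ≤ p)
    (hsurj : W.HasSurjectiveModNGaloisRep p) {E : ℕ} [NeZero (p ^ E)] (hE : 1 ≤ E)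
    {ζ : AlgebraicClosure ℚ} (hζ : IsPrimitiveRoot ζ (p ^ E)) {x y : AlgebraicClosure ℚ}
    (hx : ∀ g ∈ (absGaloisRestrict ℚ K).range, g • x = x) (hyp : y ^ p = x)
    (hy : ∀ g ∈ (absGaloisRestrict ℚ K).range, g • ζ = ζ → galoisRepTorsion W p g = 1 →
      g • y = y) :
    ∀ g ∈ (absGaloisRestrict ℚ K).range, g • ζ = ζ → g • y = y := by
  have hp : p.Prime := Fact.out
  set H := (absGaloisRestrict ℚ K).range with hH
  by_cases hy0 : y = 0
  · intro g _ _; rw [hy0, smul_zero]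
  -- `H₀ = H ∩ Stab ζ`, `S = H₀ ∩ Stab y`
  set H₀ : Subgroup (absoluteGaloisGroup ℚ) := H ⊓ MulAction.stabilizer _ ζ with hH₀
  set S : Subgroup (absoluteGaloisGroup ℚ) := H₀ ⊓ MulAction.stabilizer _ y with hS
  have hmemH₀ : ∀ g, g ∈ H₀ ↔ g ∈ H ∧ g • ζ = ζ := fun g ↦ by
    rw [hH₀, Subgroup.mem_inf, MulAction.mem_stabilizer_iff]
  have hmemS : ∀ g, g ∈ S ↔ g ∈ H₀ ∧ g • y = y := fun g ↦ by
    rw [hS, Subgroup.mem_inf, MulAction.mem_stabilizer_iff]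
  -- the cocycle `ω_g = g y / y` on `H₀`: a `p`-th root of unity fixed by `H₀`, multiplicative
  have hω : ∀ g ∈ H₀, (g • y * y⁻¹) ^ p = 1 := fun g hg ↦ by
    rw [mul_pow, ← smul_pow', hyp, hx g ((hmemH₀ g).mp hg).1, inv_pow, ← hyp,
      mul_inv_cancel₀ (pow_ne_zero p hy0)]
  have hωfix : ∀ g ∈ H₀, ∀ h ∈ H₀, h • (g • y * y⁻¹) = g • y * y⁻¹ := fun g hg h hh ↦ by
    have hpow : (g • y * y⁻¹) ^ (p ^ E) = 1 := by
      obtain ⟨k, hk⟩ : p ∣ p ^ E := dvd_pow_self p (by omega)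
      rw [hk, pow_mul, hω g hg, one_pow]
    exact smul_eq_self_of_cyclotomicCharacter_eq_one hE
      (cyclotomicCharacter_eq_one_of_smul_eq hζ ((hmemH₀ h).mp hh).2) hpow
  have hmul : ∀ g ∈ H₀, ∀ h ∈ H₀, (g * h) • y * y⁻¹ = (g • y * y⁻¹) * (h • y * y⁻¹) :=
    fun g hg h hh ↦ by
    have h1 : h • y = (h • y * y⁻¹) * y := by rw [inv_mul_cancel_right₀ hy0]
    rw [mul_smul, h1, smul_mul', hωfix h hh g hg]
    field_simp
  have hone : ∀ g ∈ H₀, (g • y * y⁻¹ = 1 ↔ g • y = y) := fun g _ ↦ by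
    rw [mul_inv_eq_one₀ hy0]
  have hinv : ∀ g ∈ H₀, g⁻¹ • y * y⁻¹ = (g • y * y⁻¹)⁻¹ := fun g hg ↦ by
    have h := hmul g hg g⁻¹ (H₀.inv_mem hg)
    rw [mul_inv_cancel, one_smul, mul_inv_cancel₀ hy0] at h
    exact (eq_inv_of_mul_eq_one_right h.symm)
  -- commutators of `H₀` fix `y`
  have hScomm : ∀ g ∈ H₀, ∀ g' ∈ H₀, g * g' * g⁻¹ * g'⁻¹ ∈ S := fun g hg g' hg' ↦ by
    refine (hmemS _).mpr ⟨H₀.mul_mem (H₀.mul_mem (H₀.mul_mem hg hg') (H₀.inv_mem hg))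
      (H₀.inv_mem hg'), ?_⟩
    rw [← hone _ (H₀.mul_mem (H₀.mul_mem (H₀.mul_mem hg hg') (H₀.inv_mem hg)) (H₀.inv_mem hg')),
      hmul _ (H₀.mul_mem (H₀.mul_mem hg hg') (H₀.inv_mem hg)) _ (H₀.inv_mem hg'),
      hmul _ (H₀.mul_mem hg hg') _ (H₀.inv_mem hg), hmul _ hg _ hg', hinv g hg, hinv g' hg']
    have hg0 : g • y * y⁻¹ ≠ 0 := fun h ↦ by
      have := hω g hg; rw [h, zero_pow hp.ne_zero] at this; exact zero_ne_one this
    have hg'0 : g' • y * y⁻¹ ≠ 0 := fun h ↦ by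
      have := hω g' hg'; rw [h, zero_pow hp.ne_zero] at this; exact zero_ne_one this
    have hgy : g • y ≠ 0 := by rw [Ne, smul_eq_zero_iff_eq]; exact hy0
    have hg'y : g' • y ≠ 0 := by rw [Ne, smul_eq_zero_iff_eq]; exact hy0
    field_simp
  -- the matrix-valued representation `R = Φ ∘ ρ̄`, onto `GL₂(𝔽_p)`
  obtain ⟨-, Φ, -, -, -, -, -⟩ := W.exists_frame_galoisRepTorsion_rat p
  set R : absoluteGaloisGroup ℚ →* GL (Fin 2) (ZMod p) :=
    Φ.toMonoidHom.comp (galoisRepTorsion W p) with hR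
  have hRsurj : Function.Surjective R := Φ.surjective.comp hsurj
  have hker : ∀ g ∈ H₀, R g = 1 → g ∈ S := fun g hg h1 ↦ by
    have h1' : galoisRepTorsion W p g = 1 := by
      apply Φ.injective
      rw [map_one]
      exact h1
    exact (hmemS g).mpr ⟨hg, hy g ((hmemH₀ g).mp hg).1 ((hmemH₀ g).mp hg).2 h1'⟩
  have hcomm : ∀ a b : absoluteGaloisGroup ℚ, a * b * a⁻¹ * b⁻¹ ∈ H₀ := fun a b ↦
    (hmemH₀ _).mpr (commutator_mem_range_and_smul_eq hK2 hE hζ a b)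
  -- conclusion
  intro g hgH hgζ
  have hg : g ∈ H₀ := (hmemH₀ g).mpr ⟨hgH, hgζ⟩
  have hpow : g ^ (p - 1) ∈ S :=
    pow_mem_of_perfect_commutator R hRsurj (commutator_commutator_top_eq hp5)
      (pow_sub_one_mem_commutator hp5) (inf_le_left : S ≤ H₀) hcomm hker hScomm hg
  -- `ω_g^{p-1} = 1` and `ω_g^p = 1`, so `ω_g = 1`
  have hωpow : ∀ n : ℕ, (g ^ n) • y * y⁻¹ = (g • y * y⁻¹) ^ n := by
    intro n
    induction n with
    | zero => rw [pow_zero, one_smul, mul_inv_cancel₀ hy0, pow_zero]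
    | succ n ih => rw [pow_succ, hmul _ (H₀.pow_mem hg n) _ hg, ih, pow_succ]
  have h1 : (g • y * y⁻¹) ^ (p - 1) = 1 := by
    rw [← hωpow, hone _ (H₀.pow_mem hg _)]
    exact ((hmemS _).mp hpow).2
  have h2 : (g • y * y⁻¹) ^ p = 1 := hω g hg
  rw [← hone g hg]
  have h3 : (g • y * y⁻¹) ^ (p - 1 + 1) = 1 := by rw [Nat.sub_add_cancel hp.one_le]; exact h2
  rw [pow_succ, h1, one_mul] at h3
  exact h3

/-! ### The fixed field of `res Γ_K` and the cyclic descent -/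

/-- **The fixed field of `res Γ_K` on `ℚ̄` is `e(K)`** for the embedding `e` characterising
`res Γ_K` (`g ∈ res Γ_K ↔ g` fixes `e(K)` pointwise; `exists_mem_range_absGaloisRestrict_iff`):
an element of `ℚ̄` fixed by `res Γ_K` is `e k` for some `k ∈ K` (infinite Galois correspondence,
Mathlib `InfiniteGalois.fixedField_fixingSubgroup`). [folklore] -/
theorem exists_eq_embedding_of_forall_smul {K : Type} [Field K] [NumberField K]
    (e : K →ₐ[ℚ] AlgebraicClosure ℚ)
    (he : ∀ g : absoluteGaloisGroup ℚ, g ∈ (absGaloisRestrict ℚ K).range ↔ ∀ k : K, g • e k = e k)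
    {s : AlgebraicClosure ℚ} (hs : ∀ g ∈ (absGaloisRestrict ℚ K).range, g • s = s) :
    ∃ k : K, e k = s := by
  haveI := Rat.isGalois_algebraicClosure
  set F : IntermediateField ℚ (AlgebraicClosure ℚ) := e.fieldRange with hF
  have hmem : s ∈ IntermediateField.fixedField F.fixingSubgroup := by
    rw [IntermediateField.mem_fixedField_iff]
    intro f hf
    have hf' : ∀ k : K, ((absoluteGaloisGroup.toAlgEquiv ℚ).symm f) • e k = e k := by
      intro k
      rw [absoluteGaloisGroup.toAlgEquiv_symm_apply]
      exact (IntermediateField.mem_fixingSubgroup_iff _ _).mp hf (e k) ⟨k, rfl⟩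
    have := hs _ ((he _).mpr hf')
    rwa [absoluteGaloisGroup.toAlgEquiv_symm_apply] at this
  rw [InfiniteGalois.fixedField_fixingSubgroup F, hF] at hmem
  exact (AlgHom.mem_fieldRange (f := e) (y := s)).mp hmem

/-- A quadratic field contains no primitive `p`-th root of unity for a prime `p ≥ 5`
(`[ℚ(ζ_p) : ℚ] = p - 1 > 2`). [folklore] -/
theorem not_isPrimitiveRoot_of_finrank_eq_two {K : Type} [Field K] [NumberField K]
    (hK2 : Module.finrank ℚ K = 2) {p : ℕ} (hp : p.Prime) (hp5 : 5 ≤ p) (k : K) :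
    ¬ IsPrimitiveRoot k p := by
  intro hk
  have h1 := Polynomial.cyclotomic_eq_minpoly_rat hk hp.pos
  have h2 : (minpoly ℚ k).natDegree ≤ Module.finrank ℚ K := minpoly.natDegree_le k
  rw [← h1, Polynomial.natDegree_cyclotomic, Nat.totient_prime hp, hK2] at h2
  omega

/-- **Cyclic descent** (`H¹(Gal(K(ζ_{p^E})/K), μ_p) = 0`). `K` quadratic, `p ≥ 5`, `ζ` a primitive
`p^E`-th root of unity (`E ≥ 1`), `H = res Γ_K` with fixed field `e(K)`.  If `y^p = x` with `x`
fixed by `H` and `y` fixed by every `g ∈ H` fixing `ζ`, then some `y₀` with `y₀^p = x` is fixed by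
all of `H`.  Proof: `ω_g = gy/y ∈ μ_p`; pick `c ∈ H` moving `ζ_p = ζ^{p^{E-1}}` (`ζ_p ∉ K`);
commutators lie in `H ∩ Stab ζ`, so `gc` and `cg` agree on `y`, giving
`ω_g^{χ(c)-1} = ω_c^{χ(g)-1}`; with `m (χ(c) - 1) ≡ 1 (mod p)` and `θ = ω_c^m`:
`ω_g = θ^{χ(g)-1} = gθ/θ`, and `y₀ = y/θ` works. [folklore] -/
theorem exists_fixed_root_of_fixed_by_stabilizer {K : Type} [Field K] [NumberField K]
    (hK2 : Module.finrank ℚ K = 2) {p : ℕ} [Fact p.Prime] (hp5 : 5 ≤ p) {E : ℕ} [NeZero (p ^ E)]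
    (hE : 1 ≤ E) {ζ : AlgebraicClosure ℚ} (hζ : IsPrimitiveRoot ζ (p ^ E))
    (e : K →ₐ[ℚ] AlgebraicClosure ℚ)
    (he : ∀ g : absoluteGaloisGroup ℚ, g ∈ (absGaloisRestrict ℚ K).range ↔ ∀ k : K, g • e k = e k)
    {x y : AlgebraicClosure ℚ} (hx : ∀ g ∈ (absGaloisRestrict ℚ K).range, g • x = x)
    (hyp : y ^ p = x) (hy : ∀ g ∈ (absGaloisRestrict ℚ K).range, g • ζ = ζ → g • y = y) :
    ∃ y₀ : AlgebraicClosure ℚ, y₀ ^ p = x ∧ ∀ g ∈ (absGaloisRestrict ℚ K).range, g • y₀ = y₀ := by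
  have hp : p.Prime := Fact.out
  haveI : Fact (1 < p ^ E) := ⟨Nat.one_lt_pow (by omega) hp.one_lt⟩
  set H := (absGaloisRestrict ℚ K).range with hH
  by_cases hy0 : y = 0
  · exact ⟨0, by rw [← hyp, hy0], fun g _ ↦ smul_zero g⟩
  set χ := modNCyclotomicCharacter ℚ (p ^ E) with hχ
  -- notation: `u g = χ(g).val`, so `g • t = t ^ u g` for every `p^E`-th root of unity `t`
  have hspec : ∀ (g : absoluteGaloisGroup ℚ) (t : AlgebraicClosure ℚ), t ^ (p ^ E) = 1 →
      g • t = t ^ (χ g : ZMod (p ^ E)).val := fun g t ht ↦ modNCyclotomicCharacter_spec ℚ (p ^ E) g t ht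
  have hpE : ∀ t : AlgebraicClosure ℚ, t ^ p = 1 → t ^ (p ^ E) = 1 := fun t ht ↦ by
    obtain ⟨k, hk⟩ : p ∣ p ^ E := dvd_pow_self p (by omega)
    rw [hk, pow_mul, ht, one_pow]
  -- `ζ_p = ζ^{p^{E-1}}`, a primitive `p`-th root of unity, is moved by some `c ∈ H`
  set ζp := ζ ^ (p ^ (E - 1)) with hζp
  have hζp : IsPrimitiveRoot ζp p :=
    hζ.pow (Nat.pos_of_ne_zero (NeZero.ne _)) (by rw [← pow_succ, Nat.sub_add_cancel hE])
  have hζpE : ζp ^ (p ^ E) = 1 := hpE ζp hζp.pow_eq_one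
  obtain ⟨c, hcH, hcζ⟩ : ∃ c ∈ H, c • ζp ≠ ζp := by
    by_contra hcon
    simp only [not_exists, not_and, not_not] at hcon
    obtain ⟨k, hk⟩ := exists_eq_embedding_of_forall_smul e he hcon
    exact not_isPrimitiveRoot_of_finrank_eq_two hK2 hp hp5 k
      (IsPrimitiveRoot.of_map_of_injective (f := e) (by rw [hk]; exact hζp) e.injective)
  -- `u c ≢ 1 (mod p)`: a Bezout coefficient `m` with `(u c - 1) m ≡ 1 (mod p)`
  set uc := (χ c : ZMod (p ^ E)).val with huc
  have hcop : Nat.Coprime (uc - 1) p := by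
    rw [Nat.coprime_comm, hp.coprime_iff_not_dvd]
    rintro ⟨j, hj⟩
    apply hcζ
    have huc1 : 1 ≤ uc := by
      rw [huc, Nat.one_le_iff_ne_zero]
      exact ZMod.val_ne_zero _ |>.mpr (Units.ne_zero _)
    rw [hspec c ζp hζpE, ← huc, ← Nat.sub_add_cancel huc1, hj, pow_succ, pow_mul, hζp.pow_eq_one,
      one_pow, one_mul]
  obtain ⟨m, -, hm⟩ := Nat.exists_mul_mod_eq_one_of_coprime hcop hp.one_lt
  -- the cocycle
  have hω : ∀ g ∈ H, (g • y * y⁻¹) ^ p = 1 := fun g hg ↦ by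
    rw [mul_pow, ← smul_pow', hyp, hx g hg, inv_pow, ← hyp, mul_inv_cancel₀ (pow_ne_zero p hy0)]
  have hωy : ∀ g ∈ H, g • y = (g • y * y⁻¹) * y := fun g _ ↦ by rw [inv_mul_cancel_right₀ hy0]
  have hω0 : ∀ g ∈ H, g • y * y⁻¹ ≠ 0 := fun g hg h ↦ by
    have := hω g hg; rw [h, zero_pow hp.ne_zero] at this; exact zero_ne_one this
  -- `(g c) • y = (c g) • y`: the commutator `g⁻¹ c⁻¹ g c` lies in `H ∩ Stab ζ`
  have hswap : ∀ g ∈ H, (g * c) • y = (c * g) • y := fun g hg ↦ by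
    obtain ⟨hdH, hdζ⟩ := commutator_mem_range_and_smul_eq hK2 hE hζ g⁻¹ c⁻¹
    rw [inv_inv, inv_inv] at hdH hdζ
    have hd := hy _ hdH hdζ
    have : g * c = c * g * (g⁻¹ * c⁻¹ * g * c) := by group
    rw [this, mul_smul (c * g), hd]
  -- `ω_g^{uc - 1} = ω_c^{u g - 1}`
  have huc1 : 1 ≤ uc := by
    rw [huc, Nat.one_le_iff_ne_zero]; exact ZMod.val_ne_zero _ |>.mpr (Units.ne_zero _)
  have hkey : ∀ g ∈ H, (g • y * y⁻¹) ^ (uc - 1) =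
      (c • y * y⁻¹) ^ ((χ g : ZMod (p ^ E)).val - 1) := fun g hg ↦ by
    have hug1 : 1 ≤ (χ g : ZMod (p ^ E)).val := by
      rw [Nat.one_le_iff_ne_zero]; exact ZMod.val_ne_zero _ |>.mpr (Units.ne_zero _)
    have hωcp : (c • y * y⁻¹) ^ (p ^ E) = 1 := hpE _ (hω c hcH)
    have hωgp : (g • y * y⁻¹) ^ (p ^ E) = 1 := hpE _ (hω g hg)
    have hωc0 := hω0 c hcH
    have hωg0 := hω0 g hg
    have h := hswap g hg
    set ωg := g • y * y⁻¹ with hωg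
    set ωc := c • y * y⁻¹ with hωc
    clear_value ωg ωc
    have hgy : g • y = ωg * y := by rw [hωg, inv_mul_cancel_right₀ hy0]
    have hcy : c • y = ωc * y := by rw [hωc, inv_mul_cancel_right₀ hy0]
    rw [mul_smul, mul_smul, hcy, hgy, smul_mul', smul_mul', hspec g ωc hωcp,
      hspec c ωg hωgp, hgy, hcy, ← huc, ← mul_assoc, ← mul_assoc] at h
    -- h : ωc ^ u_g * ωg * y = ωg ^ uc * ωc * y
    have h' := mul_right_cancel₀ hy0 h
    obtain ⟨n, hn⟩ : ∃ n, (χ g : ZMod (p ^ E)).val = n + 1 := ⟨_, (Nat.sub_add_cancel hug1).symm⟩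
    obtain ⟨n', hn'⟩ : ∃ n', uc = n' + 1 := ⟨_, (Nat.sub_add_cancel huc1).symm⟩
    rw [hn, hn', pow_succ, pow_succ] at h'
    rw [hn, hn', Nat.add_sub_cancel, Nat.add_sub_cancel]
    -- h' : ωc ^ n * ωc * ωg = ωg ^ n' * ωg * ωc
    have h'' : ωg ^ n' * (ωc * ωg) = ωc ^ n * (ωc * ωg) := by linear_combination -h'
    exact mul_right_cancel₀ (mul_ne_zero hωc0 hωg0) h''
  -- `θ = ω_c^m`
  set θ := (c • y * y⁻¹) ^ m with hθ
  have hθp : θ ^ p = 1 := by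
    rw [hθ, ← pow_mul, mul_comm m p, pow_mul, hω c hcH, one_pow]
  have hθpE : θ ^ (p ^ E) = 1 := hpE θ hθp
  have hθ0 : θ ≠ 0 := pow_ne_zero m (hω0 c hcH)
  have hωθ : ∀ g ∈ H, g • y * y⁻¹ = θ ^ ((χ g : ZMod (p ^ E)).val - 1) := fun g hg ↦ by
    -- `ω_g = ω_g^{(uc-1) m} = (ω_c^{u g - 1})^m = θ^{u g - 1}`
    have h1 : g • y * y⁻¹ = (g • y * y⁻¹) ^ ((uc - 1) * m) := by
      conv_lhs => rw [← pow_one (g • y * y⁻¹)]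
      rw [← Nat.div_add_mod ((uc - 1) * m) p, hm, pow_add, pow_mul, hω g hg, one_pow, one_mul]
    rw [h1, pow_mul, hkey g hg, ← pow_mul, mul_comm ((χ g : ZMod (p ^ E)).val - 1) m, pow_mul]
  refine ⟨y * θ⁻¹, ?_, fun g hg ↦ ?_⟩
  · rw [mul_pow, inv_pow, hyp, hθp, inv_one, mul_one]
  · have hug1 : 1 ≤ (χ g : ZMod (p ^ E)).val := by
      rw [Nat.one_le_iff_ne_zero]; exact ZMod.val_ne_zero _ |>.mpr (Units.ne_zero _)
    obtain ⟨n, hn⟩ : ∃ n, (χ g : ZMod (p ^ E)).val = n + 1 := ⟨_, (Nat.sub_add_cancel hug1).symm⟩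
    have hgy : g • y = θ ^ n * y := by
      rw [← inv_mul_cancel_right₀ hy0 (g • y), hωθ g hg, hn, Nat.add_sub_cancel]
    rw [smul_mul', smul_inv'', hspec g θ hθpE, hgy, hn, pow_succ]
    field_simp

end Summit.BirchSwinnertonDyer.BirchSwinnertonDyer.Theorems.AuxPrimeSupply

end
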